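import Mathlib
import Summits.ValiantsHypothesis.ValiantsHypothesis.Theorems.FifoMatchingNNDivisionHardArcElimination
import Summits.ValiantsHypothesis.ValiantsHypothesis.Theorems.FifoMatchingNNDivisionHardSupportBetween
import Summits.ValiantsHypothesis.ValiantsHypothesis.Theorems.FifoMatchingNNDivisionHardLongSpreadLaw
import Summits.ValiantsHypothesis.ValiantsHypothesis.Theorems.FifoMatchingNNDivisionHardCorSandwich
import HarnessLib

/-!
# Route FifoMatching — crux `NNDivisionHard` (stmt-ValiantsHypothesis-21181): SHORT-ARC-AVOIDING FACES ARE HARD, and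
# BINOMIAL POWERS `(a·x^P + b·x^Q)^D` ARE NOT CERTIFICATES (every degree `D`)

Companion of `…ArcElimination.lean` (`complexity_arcAvoidingFace_le_of_binomialPow`: a certificate with cofactor
`(a·x^P + b·x^Q)^D`, `P` nest-free, `Q ≠ P`, computes the single-arc-avoiding face `NN_n^{¬{e}}` for any arc `e` of `Q` outside
`P`, at polynomial cost).  Here the face is shown to be hard when `e` is SHORT:

* `support_arcAvoidingFace_subset`, `arcExponent_mem_support_arcAvoidingFace` — support bookkeeping of the face;
* ★★ `shortArcFace_exp_lower_bound` — **eventually in `n`, `2^{n^{1/6}} ≤ L₊(NN_n^{¬{e}}) + 1` for every arc variable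
  `e = (i, j)` with `(j − i)³ ≤ n²`**: the long-arc thick-queue measure behind `…LongSpreadLaw.exp_lower_bound_of_longSpreadLaw`
  lives on nest-free perfect matchings all of whose arcs are longer than `e`, i.e. inside the support of the face, and the
  support-between union bound `…SupportBetween.one_le_complexity_mul_of_spread_of_support_between` applies;
* ★★ `binomialPow_exp_lower_bound` / `binomialPow_not_certificate_qp` — **for every `c`, eventually in `n`: for every
  nest-free perfect matching `P`, perfect matching `Q`, opener `i` of `Q` with `P i ≠ Q i` and `(Q i − i)³ ≤ n²`, `a ≠ 0`, `b`
  and EVERY `D`, the cofactor `h = (a·x^P + b·x^Q)^D` has `2^((log₂ n + c)^c) < L₊(NN_n · h) + L₊(h)`** (absorption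
  arithmetic `absorb_arith`, `absorb_exp`).  These cofactors are cheap by repeated squaring, torus-homogeneous, spread and of
  arbitrary (e.g. doubly-exponential) degree.

HONEST FRAMING: one explicit family for ONE candidate; the long-arc case (`P △ Q` consisting of long arcs only) is left to the
band measures; stmt-21181 stays OPEN; nothing here bears on `NNNotVP` or on VP ≠ VNP (NOT proved).  No definitions, no named
facts.
References: Hrubeš–Yehudayoff 2021 §6 Problem 2 [HrubesYehudayoff2021]; Jukna–Seiwert–Sergeev 2022 Thm 1
[JuknaSeiwertSergeev2022]; Jerrum–Snir 1982 [JerrumSnir1982].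
-/

noncomputable section

-- Sub = Summit single-conjunct layout: the duplicated namespace component is mandated by the tree.
set_option linter.dupNamespace false
set_option autoImplicit false

namespace Summit.ValiantsHypothesis.ValiantsHypothesis.Theorems.FifoMatching.NNDivisionHard.BinomialPowers

open Finset MvPolynomial Literature.Computability.AlgebraicComplexity
open Summit.ValiantsHypothesis.ValiantsHypothesis.Theorems.FifoMatching.NNDivisionHard.ArcElimination
  (complexity_arcAvoidingFace_le_of_binomialPow)
open Summit.ValiantsHypothesis.ValiantsHypothesis.Theorems.FifoMatching.NNDivisionHard.SupportBetween
  (one_le_complexity_mul_of_spread_of_support_between)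
open Summit.ValiantsHypothesis.ValiantsHypothesis.Theorems.FifoMatching.NNDivisionHard.LongSpreadLaw
  (exp_lower_bound_of_longSpreadLaw)
open scoped NNReal BigOperators

variable {n : ℕ}

/-! ### §1 Support bookkeeping of an avoiding face -/

/-- The `I`-avoiding face is a sub-sum of `NN_n`: its support lies in that of `NN_n`. [folklore] -/
theorem support_arcAvoidingFace_subset (I : Finset (Fin (2 * n) × Fin (2 * n))) :
    (∑ M ∈ (nestFreeMatchings (2 * n)).filter (fun M => ∀ j ∈ openers M, (j, M j) ∉ I),
        arcMonomial ℝ≥0 M).support ⊆ (nestFreeMatchingPoly n ℝ≥0).support := by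
  classical
  intro x hx
  rw [support_sum_arcMonomial ((Finset.filter_subset _ _).trans nestFreeMatchings_subset_perfectMatchings),
    Finset.mem_image] at hx
  obtain ⟨M, hM, rfl⟩ := hx
  rw [nestFreeMatchingPoly_eq_sum_arcMonomial, support_sum_arcMonomial nestFreeMatchings_subset_perfectMatchings]
  exact Finset.mem_image.2 ⟨M, (Finset.mem_filter.1 hM).1, rfl⟩

/-- A nest-free perfect matching avoiding `I` is a monomial of the `I`-avoiding face. [folklore] -/
theorem arcExponent_mem_support_arcAvoidingFace (I : Finset (Fin (2 * n) × Fin (2 * n))) {M : Fin (2 * n) → Fin (2 * n)}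
    (hM : M ∈ nestFreeMatchings (2 * n)) (havoid : ∀ j ∈ openers M, (j, M j) ∉ I) :
    arcExponent M ∈ (∑ M ∈ (nestFreeMatchings (2 * n)).filter (fun M => ∀ j ∈ openers M, (j, M j) ∉ I),
        arcMonomial ℝ≥0 M).support := by
  classical
  rw [support_sum_arcMonomial ((Finset.filter_subset _ _).trans nestFreeMatchings_subset_perfectMatchings)]
  exact Finset.mem_image.2 ⟨M, Finset.mem_filter.2 ⟨hM, havoid⟩, rfl⟩

/-! ### §2 Short-arc-avoiding faces are hard -/

/-- ★★ **EVERY SHORT-ARC-AVOIDING FACE IS HARD.**  Eventually in `n`: for every arc variable `e = (i, j)` with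
`(j − i)³ ≤ n²`, `2^{n^{1/6}} ≤ L₊(NN_n^{¬{e}}) + 1` — the long-arc thick-queue measure of `…LongSpreadLaw` lives on nest-free
perfect matchings all of whose arcs are longer than `e`, i.e. inside the support of the face, and the support-between union
bound applies. [cite: HrubesYehudayoff2021, §6 Problem 2] -/
theorem shortArcFace_exp_lower_bound : ∃ n₀ : ℕ, ∀ n : ℕ, n₀ ≤ n → ∀ e : Fin (2 * n) × Fin (2 * n),
    ((e.2 : ℕ) - (e.1 : ℕ)) ^ 3 ≤ n ^ 2 →
      (2 : ℝ) ^ ((n : ℝ) ^ ((1 : ℝ) / 6)) ≤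
        ((complexity (∑ M ∈ (nestFreeMatchings (2 * n)).filter (fun M => ∀ j ∈ openers M, (j, M j) ∉ ({e} :
          Finset (Fin (2 * n) × Fin (2 * n)))), arcMonomial ℝ≥0 M) + 1 : ℕ) : ℝ) := by
  classical
  -- the class of short-arc-avoiding faces and its least cost
  let good : (n : ℕ) → Set ℕ := fun n => {L | ∃ e : Fin (2 * n) × Fin (2 * n), ((e.2 : ℕ) - (e.1 : ℕ)) ^ 3 ≤ n ^ 2 ∧
    L = complexity (∑ M ∈ (nestFreeMatchings (2 * n)).filter (fun M => ∀ j ∈ openers M, (j, M j) ∉ ({e} :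
          Finset (Fin (2 * n) × Fin (2 * n)))), arcMonomial ℝ≥0 M) + 1}
  set F : ℕ → ℕ := fun n => sInf (good n) with hF
  have hmem : ∀ n, 3 ≤ n → F n ∈ good n := fun n hn => by
    have h0 : 0 < 2 * n := by omega
    exact Nat.sInf_mem ⟨_, ⟨(⟨0, h0⟩, ⟨0, h0⟩), by simp, rfl⟩⟩
  obtain ⟨n₀, hn₀⟩ := exp_lower_bound_of_longSpreadLaw F (fun n hn ℓ₀ hℓ3 hℓn β μ hμ hμlong hS => by
    obtain ⟨e, he, hL⟩ := hmem n hn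
    rw [hL]
    have hshort : (e.2 : ℕ) < (e.1 : ℕ) + ℓ₀ := by
      have h1 : ((e.2 : ℕ) - (e.1 : ℕ)) ^ 3 < ℓ₀ ^ 3 := lt_of_le_of_lt he hℓ3
      have h2 : (e.2 : ℕ) - (e.1 : ℕ) < ℓ₀ := (Nat.pow_lt_pow_iff_left (by norm_num)).1 h1
      omega
    have havoid : ∀ M ∈ nestFreeMatchings (2 * n), μ M ≠ 0 → ∀ j ∈ openers M,
        (j, M j) ∉ ({e} : Finset (Fin (2 * n) × Fin (2 * n))) := by
      intro M hM hμM j hj hje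
      rw [Finset.mem_singleton] at hje
      have hlong := hμlong M hM hμM j hj
      rw [← hje] at hshort
      simp only at hshort
      omega
    have hone := one_le_complexity_mul_of_spread_of_support_between hn (support_arcAvoidingFace_subset {e}) μ hμ
      (fun M hM hμM => arcExponent_mem_support_arcAvoidingFace {e} hM (havoid M hM hμM)) hS
    set G := complexity (∑ M ∈ (nestFreeMatchings (2 * n)).filter (fun M => ∀ j ∈ openers M,
        (j, M j) ∉ ({e} : Finset (Fin (2 * n) × Fin (2 * n)))), arcMonomial ℝ≥0 M) with hG
    have hle : (G : ℝ) ≤ ((G + 1 : ℕ) : ℝ) := by exact_mod_cast Nat.le_succ G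
    calc (1 : ℝ) ≤ 4 * (G : ℝ) * ((n : ℝ) + 1) ^ 2 * (β : ℝ) := hone
      _ ≤ 4 * ((G + 1 : ℕ) : ℝ) * ((n : ℝ) + 1) ^ 2 * (β : ℝ) := by gcongr)
  refine ⟨max n₀ 3, fun n hn e he => ?_⟩
  have hn0 : n₀ ≤ n := le_trans (le_max_left _ _) hn
  have hn3 : 3 ≤ n := le_trans (le_max_right _ _) hn
  have hle : F n ≤ complexity (∑ M ∈ (nestFreeMatchings (2 * n)).filter (fun M => ∀ j ∈ openers M,
        (j, M j) ∉ ({e} : Finset (Fin (2 * n) × Fin (2 * n)))), arcMonomial ℝ≥0 M) + 1 :=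
    Nat.sInf_le ⟨e, he, rfl⟩
  exact (hn₀ n hn0).trans (by exact_mod_cast hle)

/-! ### §3 Binomial powers differing at a short arc are not certificates -/

/-- ★★ **BINOMIAL POWERS, stretched-exponential form.**  Eventually in `n`: for every nest-free perfect matching `P`, perfect
matching `Q`, opener `i` of `Q` with `P i ≠ Q i` and `(Q i − i)³ ≤ n²` (a SHORT arc of `Q` outside `P`), `a ≠ 0`, `b`, `D`:
`2^{n^{1/6}} ≤ 16 ((2n+1) (L₊(NN_n · (a·x^P + b·x^Q)^D) + 2))² + 1`. [cite: HrubesYehudayoff2021, §6 Problem 2]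
[cite: JuknaSeiwertSergeev2022, Thm 1] -/
theorem binomialPow_exp_lower_bound : ∃ n₀ : ℕ, ∀ n : ℕ, n₀ ≤ n → ∀ P Q : Fin (2 * n) → Fin (2 * n),
    P ∈ nestFreeMatchings (2 * n) → Q ∈ perfectMatchings (2 * n) → ∀ i : Fin (2 * n), i < Q i → P i ≠ Q i →
    ((Q i : ℕ) - (i : ℕ)) ^ 3 ≤ n ^ 2 → ∀ a b : ℝ≥0, a ≠ 0 → ∀ D : ℕ,
      (2 : ℝ) ^ ((n : ℝ) ^ ((1 : ℝ) / 6)) ≤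
        ((16 * ((2 * n + 1) * (complexity (nestFreeMatchingPoly n ℝ≥0 *
          (C a * arcMonomial ℝ≥0 P + C b * arcMonomial ℝ≥0 Q) ^ D) + 2)) ^ 2 + 1 : ℕ) : ℝ) := by
  obtain ⟨n₀, hn₀⟩ := shortArcFace_exp_lower_bound
  refine ⟨n₀, fun n hn P Q hP hQ i hi hPQ hshort a b ha D => ?_⟩
  have h1 := hn₀ n hn (i, Q i) hshort
  have h2 := complexity_arcAvoidingFace_le_of_binomialPow hP hQ hi hPQ ha b D
  refine h1.trans ?_
  exact_mod_cast Nat.add_le_add_right h2 1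

/-- Absorption arithmetic: `16 ((2n+1)(L+2))² + 1 ≤ 2^(2E + 2ℓ + 13)` for `L ≤ T = 2^E`, `E = (ℓ + c)^c`, `ℓ = log₂ n`.
[folklore] -/
theorem absorb_arith (n c L : ℕ) (hL : L ≤ 2 ^ ((Nat.log 2 n + c) ^ c)) :
    16 * ((2 * n + 1) * (L + 2)) ^ 2 + 1 ≤ 2 ^ (2 * (Nat.log 2 n + c) ^ c + 2 * Nat.log 2 n + 13) := by
  set ℓ := Nat.log 2 n with hℓ
  set E := (ℓ + c) ^ c with hE
  have hn : n < 2 ^ (ℓ + 1) := Nat.lt_pow_succ_log_self Nat.one_lt_two n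
  have h1 : 2 * n + 1 ≤ 2 ^ (ℓ + 2) := by rw [pow_succ]; omega
  have h2 : L + 2 ≤ 2 ^ (E + 2) := by
    rw [pow_add]; have := Nat.one_le_two_pow (n := E); omega
  have h3 : (2 * n + 1) * (L + 2) ≤ 2 ^ (ℓ + 2) * 2 ^ (E + 2) := Nat.mul_le_mul h1 h2
  have h4 : ((2 * n + 1) * (L + 2)) ^ 2 ≤ (2 ^ (ℓ + 2) * 2 ^ (E + 2)) ^ 2 := Nat.pow_le_pow_left h3 2
  have h5 : (2 ^ (ℓ + 2) * 2 ^ (E + 2)) ^ 2 = 2 ^ (2 * E + 2 * ℓ + 8) := by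
    rw [← pow_add, ← pow_mul]; congr 1; ring
  have h6 : 2 ^ (2 * E + 2 * ℓ + 13) = 32 * 2 ^ (2 * E + 2 * ℓ + 8) := by
    rw [show 2 * E + 2 * ℓ + 13 = (2 * E + 2 * ℓ + 8) + 5 by ring, pow_add]; ring
  have h7 : 1 ≤ 2 ^ (2 * E + 2 * ℓ + 8) := Nat.one_le_two_pow
  rw [h5] at h4
  rw [h6]
  omega

/-- Exponent absorption: `2 (ℓ + c)^c + 2ℓ + 13 ≤ (ℓ + (c + 14))^(c + 14)`. [folklore] -/
theorem absorb_exp (ℓ c : ℕ) : 2 * (ℓ + c) ^ c + 2 * ℓ + 13 ≤ (ℓ + (c + 14)) ^ (c + 14) := by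
  set K := c + 14 with hK
  have hK1 : 4 ≤ ℓ + K := by omega
  have h1 : (ℓ + c) ^ c ≤ (ℓ + K) ^ (c + 13) :=
    (Nat.pow_le_pow_left (by omega) c).trans (Nat.pow_le_pow_right (by omega) (by omega))
  have h2 : ℓ + K ≤ (ℓ + K) ^ (c + 13) := by
    calc ℓ + K = (ℓ + K) ^ 1 := (pow_one _).symm
      _ ≤ (ℓ + K) ^ (c + 13) := Nat.pow_le_pow_right (by omega) (by omega)
  have h3 : 2 * (ℓ + c) ^ c + 2 * ℓ + 13 ≤ 4 * (ℓ + K) ^ (c + 13) := by omega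
  calc 2 * (ℓ + c) ^ c + 2 * ℓ + 13 ≤ 4 * (ℓ + K) ^ (c + 13) := h3
    _ ≤ (ℓ + K) * (ℓ + K) ^ (c + 13) := Nat.mul_le_mul_right _ hK1
    _ = (ℓ + K) ^ (c + 14) := by rw [pow_succ]; ring

/-- ★★ **BINOMIAL POWERS ARE NOT CERTIFICATES (currency of stmt-21181).**  For every `c`, eventually in `n`: for `P`, `Q`,
`i`, `a ≠ 0`, `b`, `D` as above (the two matchings differ at a short arc `(i, Q i)` of `Q`), the cofactor
`h = (a·x^P + b·x^Q)^D` satisfies `2^((log₂ n + c)^c) < L₊(NN_n · h) + L₊(h)` — for EVERY degree `D`.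
[cite: HrubesYehudayoff2021, §6 Problem 2] -/
theorem binomialPow_not_certificate_qp (c : ℕ) : ∃ n₀ : ℕ, ∀ n : ℕ, n₀ ≤ n → ∀ P Q : Fin (2 * n) → Fin (2 * n),
    P ∈ nestFreeMatchings (2 * n) → Q ∈ perfectMatchings (2 * n) → ∀ i : Fin (2 * n), i < Q i → P i ≠ Q i →
    ((Q i : ℕ) - (i : ℕ)) ^ 3 ≤ n ^ 2 → ∀ a b : ℝ≥0, a ≠ 0 → ∀ D : ℕ,
      2 ^ ((Nat.log 2 n + c) ^ c) <
        complexity (nestFreeMatchingPoly n ℝ≥0 * (C a * arcMonomial ℝ≥0 P + C b * arcMonomial ℝ≥0 Q) ^ D) +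
          complexity ((C a * arcMonomial ℝ≥0 P + C b * arcMonomial ℝ≥0 Q) ^ D) := by
  obtain ⟨n₁, hn₁⟩ := binomialPow_exp_lower_bound
  set K : ℕ := c + 14 with hK
  obtain ⟨n₂, hn₂⟩ := CorSandwich.polylog_lt_rpow_eventually K (c := 1 / 6) (by norm_num)
  refine ⟨max n₁ n₂, fun n hn P Q hP hQ i hi hPQ hshort a b ha D => ?_⟩
  have hn1 : n₁ ≤ n := le_trans (le_max_left _ _) hn
  have hn2 : n₂ ≤ n := le_trans (le_max_right _ _) hn
  set L := complexity (nestFreeMatchingPoly n ℝ≥0 * (C a * arcMonomial ℝ≥0 P + C b * arcMonomial ℝ≥0 Q) ^ D)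
    with hL
  by_contra hle
  push Not at hle
  have hb1 : L ≤ 2 ^ ((Nat.log 2 n + c) ^ c) := le_trans (Nat.le_add_right _ _) hle
  -- the stretched-exponential bound against the quasi-polynomial one
  have h1 := hn₁ n hn1 P Q hP hQ i hi hPQ hshort a b ha D
  have h2 := hn₂ n hn2
  have h3 : (2 : ℝ) ^ ((((Nat.log 2 n + K) ^ K : ℕ) : ℝ)) < (2 : ℝ) ^ ((n : ℝ) ^ ((1 : ℝ) / 6)) :=
    Real.rpow_lt_rpow_of_exponent_lt (by norm_num) h2
  have h4 : ((2 ^ ((Nat.log 2 n + K) ^ K) : ℕ) : ℝ) <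
      ((16 * ((2 * n + 1) * (L + 2)) ^ 2 + 1 : ℕ) : ℝ) := by
    rw [Nat.cast_pow, Nat.cast_ofNat, ← Real.rpow_natCast]
    exact h3.trans_le h1
  have h5 : 2 ^ ((Nat.log 2 n + K) ^ K) < 16 * ((2 * n + 1) * (L + 2)) ^ 2 + 1 := by exact_mod_cast h4
  -- absorption
  have e1 := absorb_arith n c L hb1
  have e3 : 2 ^ (2 * (Nat.log 2 n + c) ^ c + 2 * Nat.log 2 n + 13) ≤ 2 ^ ((Nat.log 2 n + K) ^ K) :=
    Nat.pow_le_pow_right (by norm_num) (absorb_exp (Nat.log 2 n) c)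
  exact absurd (lt_of_lt_of_le h5 (e1.trans e3)) (lt_irrefl _)

end Summit.ValiantsHypothesis.ValiantsHypothesis.Theorems.FifoMatching.NNDivisionHard.BinomialPowers

end
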